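import Mathlib
import Summits.NavierStokesRegularity.NavierStokesRegularity.Theorems.EulerZoomLiouvillePowerGaugeEulerLiouvilleNeedleStableDirection
import Summits.NavierStokesRegularity.NavierStokesRegularity.Theorems.EulerZoomLiouvillePowerGaugeEulerLiouvilleNeedleLingerLaSalle
import Literature.Dynamics.FixedPoints.StableDirectionBackwardBasinNull
import Summits.NavierStokesRegularity.NavierStokesRegularity.Theorems.EulerZoomLiouvillePowerGaugeEulerLiouvilleSelfSimilarVorticalEscape

/-!
# THEOREM A (nsreg-p2 ROUND-41): THE α-LIMIT CENSUS — vortical eternal lingerers in a ball with COUNTABLY many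
# stagnation nodes are Lebesgue-NULL (R41 THEOREM A chain, file 3/3: the assembly; `NsregP2.R41.TheoremAFinite` unconditional)

Width piece for crux `EulerZoomLiouville.PowerGaugeEulerLiouville` (stmt-NavierStokesRegularity-19832), by name under
LEAD 19832 (ns-typeII-p2); seat ns-ezl-w2 g4 (lane T5, α-limit assemblies), `--supports … --as helper`.

SETTING (the cut-off formalism of THE ONE STATEMENT's clock predicates `HasResidenceClock`): `(U, P)` a self-similar Euler
profile with `γ < ½`; `V` a `C¹` cut-off copy, `‖DV‖ ≤ K`, `V = U` on `ball 0 R_big ⊃ B̄(0, M)`; backward similarity flow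
`Ψ_σ y = Φ_{−σ} y` of `W_V = γy + V` (`Literature.Analysis.ODE.evolutionMap`).  An ETERNAL VORTICAL LINGERER is a label `y`
with `curl U y ≠ 0` and `‖Ψ_σ y‖ ≤ M` for all `σ ≥ 0` (the `σ = ∞` idealisation of `¬HasResidenceClock`'s lingering half-blobs).

* `false_of_linger_tendsto_source` — **SOURCES CANNOT HOST (R41 (E3)(b)):** a vortical eternal lingerer cannot converge to a
  point `z` with `⟪DU(z)w, w⟫ ≤ 2γ‖w‖²` (near `z` every stretching rate is `≤ s₀ = (2γ+1)/2 < 1`; re-base at the entry time,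
  the label is still vortical (E2), and t40h′ (V) `linger_length_le_of_subcritical_visit` bounds the REMAINING lingering time);
* **`volume_eternalVorticalLingerers_eq_zero_of_countable`** — THEOREM A: if `{z ∈ B̄(0,M) | W_U z = 0}` is COUNTABLE then
  `volume {y | curl U y ≠ 0 ∧ ∀ σ ≥ 0, ‖Ψ_σ y‖ ≤ M} = 0`.  Proof: each such `y` converges to one node `z` (file 2,
  `exists_tendsto_flow_of_linger_of_countable`); by the host dichotomy (file 1, `stableDirection_or_source_of_mem_nodalSet`)
  `z` is a source — impossible — or `DW(z)` has a stable direction, and then `y` lies in the backward basin of `z` for the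
  cut-off field, Lebesgue-null by the fact-free (IM1) `Literature.Dynamics.FixedPoints.volume_setOf_tendsto_evolutionMap_neg_
  eq_zero_of_stableDirection` (nsreg-typer g25, p661505); countably many null basins;
* `volume_eternalVorticalLingerers_eq_zero_of_finite` / **`theoremA_finite`** — the finite (isolated-nodes) case = the text of
  nsreg-p2's Sketch41 `NsregP2.R41.TheoremAFinite` with its hypothesis `UnstableSetNull` DISCHARGED (and `V ∈ C¹` sufficing).

READING for THE ONE STATEMENT (`Sig.stub_selfSimilarC2Needle`, binder `¬HasResidenceClock`): by (F1) FATOU of R41 §2 a positive-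
measure set of labels of a vortical blob lingers at infinitely many scales; Theorem A says the ones with BOUNDED backward orbits
contribute measure zero UNLESS the stagnation set of `W_U` is uncountable in some ball — the needle's lingering mass is carried by
unbounded-but-sub-ballistic orbits or by a WILD (uncountable: curves/continua) stagnation set (R41 §5; Fenichel/(IM2) not used).
HONEST FRAMING: portrait mathematics for HYPOTHETICAL self-similar Euler profiles (MODEL lattice of the crux class); no binder of
THE ONE STATEMENT is discharged; 19832 OPEN; not NS, not E.
[folklore; cf. ConstantinIgnatovaVicol2026Putative §3.4.3, §3.5 Thms 3.8–3.10; Teschl2012 §9.1/§3.2; Kelley 1967]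
-/

noncomputable section

open Set Filter Topology Metric Function MeasureTheory
open scoped RealInnerProductSpace NNReal ENNReal

set_option linter.dupNamespace false

namespace Summit.NavierStokesRegularity.NavierStokesRegularity.Theorems.PowerGaugeEulerLiouville.NeedleClock

open Literature.Analysis Literature.Analysis.FluidPDE Literature.Dynamics.FixedPoints
open Summit.NavierStokesRegularity.NavierStokesRegularity.Theorems.PowerGaugeEulerLiouville

variable {γ : ℝ} {U V : EuclideanSpace ℝ (Fin 3) → EuclideanSpace ℝ (Fin 3)} {P : EuclideanSpace ℝ (Fin 3) → ℝ}

/-! ### Sources cannot host vortical labels -/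

/-- **SOURCES CANNOT HOST (R41 (E3)(b)).**  `V ∈ C¹`, `‖DV‖ ≤ K`, `V = U` on `ball 0 R_big ⊃ B̄(0,M)`, `γ < ½`.  A label `y`
with `curl U y ≠ 0` whose backward orbit lingers in `B̄(0, M)` forever cannot converge to a point `z` at which every stretching
rate is subcritical in the form `⟪DU(z)w, w⟫ ≤ 2γ‖w‖²` (e.g. a node with `DW(z) ⪰ 0`, t41a): by continuity of `DU` the rates
are `≤ s₀ = (2γ+1)/2 < 1` on a neighbourhood which the orbit enters for good at some `σ₀`; the re-based label `Ψ_{σ₀} y` is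
still vortical (E2) and lingers in that neighbourhood for every length `L`, against (V) `L ≤ log(O/ω)/(1 − s₀)`.
[cite: ConstantinIgnatovaVicol2026Putative, §3.4.1 eq. (3.24) and §3.5 proof of Thm 3.8] -/
theorem false_of_linger_tendsto_source (hprof : IsSelfSimilarEulerProfile γ 0 U P) (hγ2 : γ < 1 / 2)
    (hV : ContDiff ℝ 1 V) {K : ℝ} (hK : ∀ y, ‖fderiv ℝ V y‖ ≤ K) {M Rbig : ℝ} (hMR : M < Rbig)
    (hVU : ∀ w ∈ ball (0 : EuclideanSpace ℝ (Fin 3)) Rbig, V w = U w) {y : EuclideanSpace ℝ (Fin 3)}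
    (hΩ : curl U y ≠ 0)
    (hy : ∀ σ, 0 ≤ σ → ‖ODE.evolutionMap (fun _ : ℝ => selfSimilarTransport γ 0 V) 0 (-σ) y‖ ≤ M)
    {z : EuclideanSpace ℝ (Fin 3)} (hsrc : ∀ w : EuclideanSpace ℝ (Fin 3), ⟪fderiv ℝ U z w, w⟫ ≤ 2 * γ * ‖w‖ ^ 2)
    (hconv : Tendsto (fun σ => ODE.evolutionMap (fun _ : ℝ => selfSimilarTransport γ 0 V) 0 (-σ) y) atTop (𝓝 z)) :
    False := by
  set Z : ℝ → EuclideanSpace ℝ (Fin 3) :=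
    fun σ => ODE.evolutionMap (fun _ : ℝ => selfSimilarTransport γ 0 V) 0 (-σ) y with hZ
  set s₀ : ℝ := (2 * γ + 1) / 2 with hs₀
  have hs₀1 : s₀ < 1 := by rw [hs₀]; linarith
  have hgap : 0 < s₀ - 2 * γ := by rw [hs₀]; linarith
  -- the subcritical neighbourhood of `z`
  have hDUc : Continuous fun x => fderiv ℝ U x := hprof.contDiff_velocity.continuous_fderiv (by norm_num)
  set O : Set (EuclideanSpace ℝ (Fin 3)) := {x | ‖fderiv ℝ U x - fderiv ℝ U z‖ < s₀ - 2 * γ} with hO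
  have hOopen : IsOpen O := isOpen_lt (hDUc.sub continuous_const).norm continuous_const
  have hzO : z ∈ O := by simp [hO, hgap]
  have hrate : ∀ x ∈ O, ∀ w : EuclideanSpace ℝ (Fin 3), ⟪fderiv ℝ U x w, w⟫ ≤ s₀ * ‖w‖ ^ 2 := by
    intro x hx w
    have e : fderiv ℝ U x w = fderiv ℝ U z w + (fderiv ℝ U x - fderiv ℝ U z) w := by
      simp only [FunLike.coe_sub, Pi.sub_apply]; abel
    rw [e, inner_add_left]
    have h1 : ⟪(fderiv ℝ U x - fderiv ℝ U z) w, w⟫ ≤ (s₀ - 2 * γ) * ‖w‖ ^ 2 := by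
      calc ⟪(fderiv ℝ U x - fderiv ℝ U z) w, w⟫ ≤ ‖(fderiv ℝ U x - fderiv ℝ U z) w‖ * ‖w‖ := real_inner_le_norm _ _
        _ ≤ (‖fderiv ℝ U x - fderiv ℝ U z‖ * ‖w‖) * ‖w‖ :=
            mul_le_mul_of_nonneg_right (ContinuousLinearMap.le_opNorm _ _) (norm_nonneg _)
        _ ≤ ((s₀ - 2 * γ) * ‖w‖) * ‖w‖ := by
            refine mul_le_mul_of_nonneg_right (mul_le_mul_of_nonneg_right (le_of_lt hx) (norm_nonneg _)) (norm_nonneg _)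
        _ = (s₀ - 2 * γ) * ‖w‖ ^ 2 := by ring
    have h2 := hsrc w
    linarith
  -- the orbit is eventually in `O`: entry time `σ₀ ≥ 0`
  have hev : ∀ᶠ σ in atTop, Z σ ∈ O := hconv (hOopen.mem_nhds hzO)
  obtain ⟨σ₀, hσ₀⟩ := (hev.and (eventually_ge_atTop 0)).exists_forall_of_atTop
  have hσ₀0 : 0 ≤ σ₀ := (hσ₀ σ₀ le_rfl).2
  -- re-base at `y' = Ψ_{σ₀} y`
  set y' : EuclideanSpace ℝ (Fin 3) := Z σ₀ with hy'
  have hreb : ∀ τ : ℝ, ODE.evolutionMap (fun _ : ℝ => selfSimilarTransport γ 0 V) 0 (-τ) y' = Z (τ + σ₀) := by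
    intro τ
    rw [hy', hZ]
    exact (flow_neg_add_of_linger (γ := γ) hV hK y τ σ₀).symm
  have hy'linger : ∀ L : ℝ, ∀ σ ∈ Icc (0 : ℝ) L,
      ‖ODE.evolutionMap (fun _ : ℝ => selfSimilarTransport γ 0 V) 0 (-σ) y'‖ ≤ M := by
    intro L σ hσ
    rw [hreb]
    exact hy _ (by linarith [hσ.1])
  have hΩ' : curl U y' ≠ 0 :=
    curl_flow_ne_zero_of_linger hprof hV hK hMR hVU hΩ (L := σ₀) (fun σ hσ => hy σ hσ.1) ⟨hσ₀0, le_rfl⟩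
  have hvisit : ∀ L : ℝ, ∀ τ ∈ Icc (0 : ℝ) L, ∀ v,
      ⟪fderiv ℝ U (ODE.evolutionMap (fun _ : ℝ => selfSimilarTransport γ 0 V) 0 (-τ) y') v, v⟫ ≤ s₀ * ‖v‖ ^ 2 := by
    intro L τ hτ v
    rw [hreb]
    exact hrate _ (hσ₀ (τ + σ₀) (by linarith [hτ.1])).1 v
  -- vorticity bound on the ball
  have hU2 : ContDiff ℝ 2 U := hprof.isSelfSimilarEulerVorticityProfile.contDiff_velocity
  obtain ⟨Oc, hOc⟩ := (isCompact_closedBall (0 : EuclideanSpace ℝ (Fin 3)) M).exists_bound_of_continuousOn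
    (differentiable_curl_of_contDiff hU2).continuous.continuousOn
  -- every lingering length is bounded: contradiction
  set Lmax : ℝ := Real.log (Oc / ‖curl U y'‖) / (1 - s₀) with hLmax
  set L : ℝ := max (Lmax + 1) 0 with hL
  have hLle : L ≤ Lmax :=
    linger_length_le_of_subcritical_visit hprof hV hK hMR hVU hOc hΩ' hs₀1 (hvisit L) (le_max_right _ _) (hy'linger L)
  have : Lmax + 1 ≤ L := le_max_left _ _
  linarith

/-! ### THEOREM A -/

/-- **THEOREM A (nsreg-p2 ROUND-41; countable-nodes form): VORTICAL ETERNAL LINGERERS ARE NULL.**  `(U, P)` a self-similar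
Euler profile with `γ < ½`; `V ∈ C¹`, `‖DV‖ ≤ K`, `V = U` on `ball 0 R_big`, `M < R_big`.  If the stagnation set of `W_U = γy + U`
in `B̄(0, M)` is COUNTABLE, then the set of labels `y` with `curl U y ≠ 0` whose backward cut-off similarity orbit stays in
`B̄(0, M)` for all `σ ≥ 0` has Lebesgue measure zero.  (LaSalle ⇒ convergence to one node; host dichotomy: sources cannot host,
every other node has a stable direction and a Lebesgue-null backward basin by (IM1); countable union.)
[cite: ConstantinIgnatovaVicol2026Putative, §3.4.3 eq. (3.33), §3.5 Thms 3.8–3.10; Teschl2012, §9.1 Thm 9.2 and §3.2 Thm 3.4] -/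
theorem volume_eternalVorticalLingerers_eq_zero_of_countable (hprof : IsSelfSimilarEulerProfile γ 0 U P)
    (hγ2 : γ < 1 / 2) (hV : ContDiff ℝ 1 V) {K : ℝ} (hK : ∀ y, ‖fderiv ℝ V y‖ ≤ K) {M Rbig : ℝ} (hMR : M < Rbig)
    (hVU : ∀ w ∈ ball (0 : EuclideanSpace ℝ (Fin 3)) Rbig, V w = U w)
    (hcount : {z : EuclideanSpace ℝ (Fin 3) | z ∈ closedBall (0 : EuclideanSpace ℝ (Fin 3)) M ∧
      selfSimilarTransport γ 0 U z = 0}.Countable) :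
    volume {y : EuclideanSpace ℝ (Fin 3) | curl U y ≠ 0 ∧
      ∀ σ : ℝ, 0 ≤ σ → ‖ODE.evolutionMap (fun _ : ℝ => selfSimilarTransport γ 0 V) 0 (-σ) y‖ ≤ M} = 0 := by
  have hVd : Differentiable ℝ V := hV.differentiable one_ne_zero
  have hUd : Differentiable ℝ U := hprof.differentiable_velocity
  -- the cut-off field and its (IM1) data
  have hF1 : ContDiff ℝ 1 (selfSimilarTransport γ 0 V) := Kelvin.contDiff_selfSimilarTransport (γ := γ) hV
  have hKF : ∀ y, ‖fderiv ℝ (selfSimilarTransport γ 0 V) y‖ ≤ |γ| + K :=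
    fun y => Kelvin.norm_fderiv_selfSimilarTransport_le (γ := γ) hVd hK y
  -- inside the ball: `W_V = W_U` to first order
  have hball : ∀ z ∈ closedBall (0 : EuclideanSpace ℝ (Fin 3)) M, z ∈ ball (0 : EuclideanSpace ℝ (Fin 3)) Rbig :=
    fun z hz => mem_ball_zero_iff.2 (lt_of_le_of_lt (mem_closedBall_zero_iff.1 hz) hMR)
  have hFz : ∀ z ∈ closedBall (0 : EuclideanSpace ℝ (Fin 3)) M, selfSimilarTransport γ 0 U z = 0 →
      selfSimilarTransport γ 0 V z = 0 := by
    intro z hz hWz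
    rw [selfSimilarTransport_apply, hVU z (hball z hz), ← selfSimilarTransport_apply, hWz]
  have hDF : ∀ z ∈ closedBall (0 : EuclideanSpace ℝ (Fin 3)) M,
      fderiv ℝ (selfSimilarTransport γ 0 V) z = fderiv ℝ (selfSimilarTransport γ 0 U) z := by
    intro z hz
    rw [(FluidPDE.hasFDerivAt_selfSimilarTransport hVd z).fderiv, (FluidPDE.hasFDerivAt_selfSimilarTransport hUd z).fderiv,
      fderiv_eq_of_agree_ball hVU (hball z hz)]
  -- the hosting nodes: stagnation points in the ball whose linearisation has a stable direction
  set Zst : Set (EuclideanSpace ℝ (Fin 3)) := {z | (z ∈ closedBall (0 : EuclideanSpace ℝ (Fin 3)) M ∧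
      selfSimilarTransport γ 0 U z = 0) ∧ ∃ v : EuclideanSpace ℝ (Fin 3), v ≠ 0 ∧
      Tendsto (fun t : ℝ => NormedSpace.exp (t • fderiv ℝ (selfSimilarTransport γ 0 V) z) v) atTop (𝓝 0)} with hZst
  have hZc : Zst.Countable := hcount.mono fun z hz => hz.1
  have hnull : ∀ z ∈ Zst, volume {y : EuclideanSpace ℝ (Fin 3) |
      Tendsto (fun t : ℝ => ODE.evolutionMap (fun _ : ℝ => selfSimilarTransport γ 0 V) 0 (-t) y) atTop (𝓝 z)} = 0 := by
    rintro z ⟨⟨hzM, hWz⟩, hst⟩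
    exact volume_setOf_tendsto_evolutionMap_neg_eq_zero_of_stableDirection (selfSimilarTransport γ 0 V) (|γ| + K) z
      hF1 hKF (hFz z hzM hWz) hst
  -- every vortical eternal lingerer lies in one of these basins
  have hsub : {y : EuclideanSpace ℝ (Fin 3) | curl U y ≠ 0 ∧
      ∀ σ : ℝ, 0 ≤ σ → ‖ODE.evolutionMap (fun _ : ℝ => selfSimilarTransport γ 0 V) 0 (-σ) y‖ ≤ M} ⊆
      ⋃ z ∈ Zst, {y : EuclideanSpace ℝ (Fin 3) |
        Tendsto (fun t : ℝ => ODE.evolutionMap (fun _ : ℝ => selfSimilarTransport γ 0 V) 0 (-t) y) atTop (𝓝 z)} := by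
    rintro y ⟨hΩ, hy⟩
    obtain ⟨z, hzM, hWz, hconv⟩ := exists_tendsto_flow_of_linger_of_countable hprof hγ2 hV hK hMR hVU hcount hy
    have hzN : z ∈ selfSimilarNodalSet γ 0 U := hWz
    rcases Stagnation.stableDirection_or_source_of_mem_nodalSet hprof hγ2 hzN with hst | ⟨-, -, hsrc⟩
    · refine mem_biUnion (⟨⟨hzM, hWz⟩, ?_⟩ : z ∈ Zst) hconv
      rw [hDF z hzM]
      exact hst
    · exact (false_of_linger_tendsto_source hprof hγ2 hV hK hMR hVU hΩ hy hsrc hconv).elim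
  exact measure_mono_null hsub ((measure_biUnion_null_iff hZc).2 hnull)

/-- **THEOREM A, finite (isolated-nodes) form.** [cite: ConstantinIgnatovaVicol2026Putative, §3.5 Thm 3.10] -/
theorem volume_eternalVorticalLingerers_eq_zero_of_finite (hprof : IsSelfSimilarEulerProfile γ 0 U P)
    (hγ2 : γ < 1 / 2) (hV : ContDiff ℝ 1 V) {K : ℝ} (hK : ∀ y, ‖fderiv ℝ V y‖ ≤ K) {M Rbig : ℝ} (hMR : M < Rbig)
    (hVU : ∀ w ∈ ball (0 : EuclideanSpace ℝ (Fin 3)) Rbig, V w = U w)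
    (hfin : {z : EuclideanSpace ℝ (Fin 3) | z ∈ closedBall (0 : EuclideanSpace ℝ (Fin 3)) M ∧
      selfSimilarTransport γ 0 U z = 0}.Finite) :
    volume {y : EuclideanSpace ℝ (Fin 3) | curl U y ≠ 0 ∧
      ∀ σ : ℝ, 0 ≤ σ → ‖ODE.evolutionMap (fun _ : ℝ => selfSimilarTransport γ 0 V) 0 (-σ) y‖ ≤ M} = 0 :=
  volume_eternalVorticalLingerers_eq_zero_of_countable hprof hγ2 hV hK hMR hVU hfin.countable

/-- **`NsregP2.R41.TheoremAFinite` UNCONDITIONAL** — the text of nsreg-p2's ROUND-41 Sketch41 Prop `TheoremAFinite` with its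
named-fact hypothesis `UnstableSetNull` («(IM1)») DISCHARGED (it is the theorem
`Literature.Dynamics.FixedPoints.unstableSetNull_of_stableDirection`, and is not even needed as an input here): for a `C²` cut-off
`V = U` on `B(0, R_big) ⊋ B̄(0, M)` of a self-similar Euler profile in the window `0 < γ < ½`, if the stagnation set of
`W = γy + U` in `B̄(0, M)` is FINITE, then vortical eternal lingerers in `B̄(0, M)` are null
(`EternalVorticalLingerersNull γ V U M` of Sketch41, spelled out). [cite: ConstantinIgnatovaVicol2026Putative, §3.5 Thm 3.10] -/
theorem theoremA_finite :
    ∀ (γ : ℝ) (U V : EuclideanSpace ℝ (Fin 3) → EuclideanSpace ℝ (Fin 3)) (P : EuclideanSpace ℝ (Fin 3) → ℝ)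
      (K M Rbig : ℝ),
      IsSelfSimilarEulerProfile γ 0 U P → 0 < γ → γ < 1 / 2 → ContDiff ℝ 2 V → (∀ y, ‖fderiv ℝ V y‖ ≤ K) → M < Rbig →
      (∀ w ∈ ball (0 : EuclideanSpace ℝ (Fin 3)) Rbig, V w = U w) →
      ({z : EuclideanSpace ℝ (Fin 3) | z ∈ closedBall (0 : EuclideanSpace ℝ (Fin 3)) M ∧
        selfSimilarTransport γ 0 U z = 0}).Finite →
      volume {y : EuclideanSpace ℝ (Fin 3) | curl U y ≠ 0 ∧
        ∀ σ : ℝ, 0 ≤ σ → ‖ODE.evolutionMap (fun _ : ℝ => selfSimilarTransport γ 0 V) 0 (-σ) y‖ ≤ M} = 0 :=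
  fun _ _ _ _ _ _ _ hprof _ hγ2 hV hK hMR hVU hfin =>
    volume_eternalVorticalLingerers_eq_zero_of_finite hprof hγ2 (hV.of_le (by norm_num)) hK hMR hVU hfin

/-! ### Appendix (same seat, after landing): the census at `σ = ∞` is UNCONDITIONAL -/

/-- **ETERNAL VORTICAL LINGERERS ARE NULL — with NO hypothesis on the stagnation set (`0 < γ < ½`).**  The tree's W3b portrait
`Loc.volume_vortical_confined_eq_zero` (ns-typeII-p1 g8, `…SelfSimilarVorticalEscape`: in a `C²` self-similar Euler profile the
vortical points admitting a backward `W_U`-half-orbit confined to `‖y‖ ≤ N` are Lebesgue-null — bad top nodes are thin, no-drift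
convergence, compactness of the bad set) CONTAINS Theorem A: the backward cut-off orbit of an eternal lingerer is such a confined
half-orbit (inside `B̄(0,M) ⊂ ball 0 R_big` the cut-off flow solves `Y′ = −W_U(Y)`).  Hence the countability hypothesis of
`volume_eternalVorticalLingerers_eq_zero_of_countable` — and R41 §5 (i) «tameness of the stagnation set» — is NOT needed at
`σ = ∞`: what THE ONE STATEMENT keeps of the α-limit census is only the finite-window / uniform-in-`R` passage law (R41 §2 (F2)–(F3)).
[folklore; three-lineage chain of the ns-regularity-ideate cell (`Loc.volume_vortical_confined_eq_zero`), re-read in the cut-off form] -/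
theorem volume_eternalVorticalLingerers_eq_zero (hprof : IsSelfSimilarEulerProfile γ 0 U P) (hγ : 0 < γ) (hγ2 : γ < 1 / 2)
    (hV : ContDiff ℝ 1 V) {K : ℝ} (hK : ∀ y, ‖fderiv ℝ V y‖ ≤ K) {M Rbig : ℝ} (hMR : M < Rbig)
    (hVU : ∀ w ∈ ball (0 : EuclideanSpace ℝ (Fin 3)) Rbig, V w = U w) :
    volume {y : EuclideanSpace ℝ (Fin 3) | curl U y ≠ 0 ∧
      ∀ σ : ℝ, 0 ≤ σ → ‖ODE.evolutionMap (fun _ : ℝ => selfSimilarTransport γ 0 V) 0 (-σ) y‖ ≤ M} = 0 := by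
  refine measure_mono_null ?_
    (Loc.volume_vortical_confined_eq_zero hprof hγ hγ2 (N := max M 1) (lt_max_iff.2 (Or.inr one_pos)))
  rintro y ⟨hΩ, hy⟩
  refine ⟨hΩ, fun σ => ODE.evolutionMap (fun _ : ℝ => selfSimilarTransport γ 0 V) 0 (-σ) y, ?_, fun t ht => ?_,
    fun t ht => (hy t ht).trans (le_max_left _ _)⟩
  · simp only [neg_zero, ODE.evolutionMap_self]
  · -- inside the ball the cut-off backward flow solves `Y′ = −W_U(Y)`
    have hmem : ODE.evolutionMap (fun _ : ℝ => selfSimilarTransport γ 0 V) 0 (-t) y ∈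
        ball (0 : EuclideanSpace ℝ (Fin 3)) Rbig :=
      mem_ball_zero_iff.2 (lt_of_le_of_lt (hy t ht) hMR)
    have h1 := C2.Kelvin.hasDerivAt_flow_neg (γ := γ) hV hK y t
    have hWeq : selfSimilarTransport γ 0 V (ODE.evolutionMap (fun _ : ℝ => selfSimilarTransport γ 0 V) 0 (-t) y) =
        selfSimilarTransport γ 0 U (ODE.evolutionMap (fun _ : ℝ => selfSimilarTransport γ 0 V) 0 (-t) y) := by
      simp only [selfSimilarTransport_apply, hVU _ hmem]
    rw [hWeq] at h1
    exact h1

/-- **The a.e. reading**: for almost every label `y`, if `curl U y ≠ 0` then its backward cut-off orbit LEAVES `B̄(0, M)` at some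
`σ ≥ 0` — every vortical blob is fed from outside every ball, for almost all of its labels (`0 < γ < ½`; any `C¹` cut-off). [folklore] -/
theorem ae_exists_norm_flow_gt_of_curl_ne_zero (hprof : IsSelfSimilarEulerProfile γ 0 U P) (hγ : 0 < γ) (hγ2 : γ < 1 / 2)
    (hV : ContDiff ℝ 1 V) {K : ℝ} (hK : ∀ y, ‖fderiv ℝ V y‖ ≤ K) {M Rbig : ℝ} (hMR : M < Rbig)
    (hVU : ∀ w ∈ ball (0 : EuclideanSpace ℝ (Fin 3)) Rbig, V w = U w) :
    ∀ᵐ y : EuclideanSpace ℝ (Fin 3) ∂volume, curl U y ≠ 0 →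
      ∃ σ : ℝ, 0 ≤ σ ∧ M < ‖ODE.evolutionMap (fun _ : ℝ => selfSimilarTransport γ 0 V) 0 (-σ) y‖ := by
  have h := volume_eternalVorticalLingerers_eq_zero hprof hγ hγ2 hV hK hMR hVU
  rw [← compl_mem_ae_iff] at h
  filter_upwards [h] with y hy
  intro hΩ
  by_contra hcon
  push Not at hcon
  exact hy ⟨hΩ, hcon⟩

end Summit.NavierStokesRegularity.NavierStokesRegularity.Theorems.PowerGaugeEulerLiouville.NeedleClock

end
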